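import Literature.NumberTheory.Automorphic.GLnBiWhittakerDistributions
import Literature.NumberTheory.Automorphic.WhittakerModelsGelfandKazhdanPairs
import Literature.NumberTheory.Automorphic.PAdicRepsJacquetAdmissibilityHolds
import Literature.NumberTheory.Automorphic.ParabolicInductionAdmissibleProofs
import HarnessLib

/-!
# Uniqueness of Whittaker functionals for `GL_n(F)`: the supercuspidal case (all `n`), and the
general case modulo a `ψ⁻¹`-Whittaker functional on the contragredient

Topic `NumberTheory/Automorphic`; a *proofs* file closing the Gelfand–Kazhdan line towards the
named fact `Literature.NumberTheory.Automorphic.rank_whittakerFunctionals_le_one` (local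
multiplicity one; Gelfand–Kazhdan 1975, Thm. C as vendored; Shalika 1974, Thm. 3.1). With
Gelfand–Kazhdan's Theorem A now in the tree for all `n` (`biWhittaker_gkInvolution_stable`,
`GLnBiWhittakerDistributions`), the hypotheses `hA`, `hA'` of the tree's Gelfand–Kazhdan criteria
(`rank_whittakerFunctionals_le_one_of_gelfandKazhdan`, `…_pair`,
`…_of_isSupercuspidal_of_gelfandKazhdan`) are discharged:

* `rank_whittakerFunctionals_le_one_of_isSupercuspidal` — **multiplicity one for irreducible
  supercuspidal representations of `GL_n(F)`, unconditionally**: for `π` irreducible smooth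
  supercuspidal and `ψ` non-trivial continuous, `dim Hom_{U_n}(π, ψ_U) ≤ 1`; equivalently the
  named fact `rank_whittakerFunctionals_le_one π ψ` holds for every supercuspidal `π`
  (`rank_whittakerFunctionals_le_one_of_isSupercuspidal'`). This is the input
  "Gelfand–Kazhdan for cuspidal representations" (Bernstein–Zelevinsky 1977, Thm. 4.4 (b)) of the
  Bernstein–Zelevinsky route to multiplicity one for all irreducible `π` (loc. cit. §4.7, via the
  cuspidal support and the Leibniz rule for the top derivative, `WhittakerTwistedJacquet`,
  `InducedWhittakerVanishing`).
* `rank_whittakerFunctionals_le_one_of_isGeneric_contragredient` — for `π` irreducible admissible: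
  if the contragredient `π̃` is `ψ⁻¹`-generic then `dim Hom_{U_n}(π, ψ_U) ≤ 1`; with Jacquet's
  admissibility theorem (`jacquetAdmissibility_gl_holds`, now in the tree, transported to any
  universe by `Representation.isAdmissible_of_jacquetAdmissibilityStatement_fin`) this gives the
  named fact `rank_whittakerFunctionals_le_one π ψ` for every `π` with `ψ⁻¹`-generic contragredient
  (`rank_whittakerFunctionals_le_one_of_isGeneric_contragredient'`).
* `rank_whittakerFunctionals_le_one_of_gelfandKazhdanForm` — for `π` irreducible admissible
  carrying a Gelfand–Kazhdan form `B(π(g) ξ, π(ᵗg⁻¹) η) = B(ξ, η)` (Gelfand–Kazhdan's Theorem B =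
  Bump 1997, Thm. 4.2.2 (i), not yet in the tree for `n ≥ 3`), `dim Hom_{U_n}(π, ψ_U) ≤ 1`; hence
  **the named fact itself from Theorem B alone** (`rank_whittakerFunctionals_le_one_of_theoremB`).

What is still missing for `rank_whittakerFunctionals_le_one` in general is therefore exactly ONE
published theorem in either of two forms: Gelfand–Kazhdan's Theorem B (`π̃ ≅ π ∘ ᵗ(·)⁻¹` for
irreducible admissible `π`; Gelfand–Kazhdan 1972, Thm. 1; Bernstein–Zelevinsky 1976, §7), or the
heredity of Whittaker functionals for parabolic induction (Bernstein–Zelevinsky 1977, 4.5–4.7 with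
Thm. 5.2; the vanishing half is the tree's `InducedWhittakerVanishing`), combined with the cuspidal
support (`bernsteinZelevinsky_support_holds`) and the supercuspidal case proved here.

Theorems only; no definition, no named fact.

## References

* I. M. Gelfand, D. A. Kazhdan, *Representations of the group GL(n, K) where K is a local field*,
  in: Lie groups and their representations (Budapest 1971), Halsted (1975), 95–118.
  [GelfandKazhdan1975]
* I. N. Bernstein, A. V. Zelevinsky, Ann. Sci. ÉNS 10 (1977), Thm. 4.4, §4.7.
  [BernsteinZelevinskyASENS1977]
* D. Bump, *Automorphic Forms and Representations* (1997), Theorems 4.4.1–4.4.2, 4.2.2. [Bump1997]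
* J. A. Shalika, *The multiplicity one theorem for GL_n*, Ann. of Math. 100 (1974), Thm. 3.1.
  [Shalika1974]
-/

open MeasureTheory

namespace Literature.NumberTheory.Automorphic

open GaloisRepresentations (glTransposeInv)

section LocalField

attribute [local instance] t2Space_generalLinearGroup locallyCompactSpace_generalLinearGroup
  nonarchimedeanGroup_gl sigmaCompactSpace_generalLinearGroup


variable {F : Type*} [Field F] [ValuativeRel F] [TopologicalSpace F] [IsNonarchimedeanLocalField F]
  {n : ℕ} {V : Type*} [AddCommGroup V] [Module ℂ V]
  (π : Representation ℂ (GL (Fin n) F) V) (ψ : AddChar F Circle)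

/-- **Multiplicity one for irreducible supercuspidal representations of `GL_n(F)`** (all `n`,
unconditionally): for `π` irreducible smooth supercuspidal and `ψ` non-trivial continuous,
`dim Hom_{U_n}(π, ψ_U) ≤ 1`. Gelfand–Kazhdan's Theorem A (`biWhittaker_gkInvolution_stable`, for
`ψ` and `ψ⁻¹`) fed into `rank_whittakerFunctionals_le_one_of_isSupercuspidal_of_gelfandKazhdan`.
(Gelfand–Kazhdan 1975; Bernstein–Zelevinsky 1977, Thm. 4.4 (b).)
[cite: GelfandKazhdan1975, Thm. C] [cite: BernsteinZelevinskyASENS1977, Theorem 4.4] -/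
theorem rank_whittakerFunctionals_le_one_of_isSupercuspidal [π.IsIrreducible] (hπ : π.IsSmooth)
    (hsc : π.IsSupercuspidal) (hψ : ψ.IsContinuousNontrivial) :
    Module.rank ℂ (whittakerFunctionals π ψ) ≤ 1 := by
  borelize (GL (Fin n) F)
  exact rank_whittakerFunctionals_le_one_of_isSupercuspidal_of_gelfandKazhdan π ψ hπ hsc hψ
    (biWhittaker_gkInvolution_stable ψ hψ) (biWhittaker_gkInvolution_stable ψ⁻¹ hψ.inv)

/-- The named fact `rank_whittakerFunctionals_le_one π ψ` holds for every supercuspidal `π`.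
[cite: GelfandKazhdan1975, Thm. C] -/
theorem rank_whittakerFunctionals_le_one_of_isSupercuspidal' (hsc : π.IsSupercuspidal) :
    rank_whittakerFunctionals_le_one π ψ :=
  fun hπ hψ => rank_whittakerFunctionals_le_one_of_isSupercuspidal π ψ hπ hsc hψ

/-- **Multiplicity one for irreducible admissible `π` whose contragredient is `ψ⁻¹`-generic**
(the two-functional Gelfand–Kazhdan criterion with Theorem A discharged). (Gelfand–Kazhdan 1975,
§2; Bernstein–Zelevinsky 1976, 5.16–5.17.) [cite: GelfandKazhdan1975, §2] -/
theorem rank_whittakerFunctionals_le_one_of_isGeneric_contragredient [π.IsIrreducible]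
    (hadm : π.IsAdmissible) (hψ : ψ.IsContinuousNontrivial)
    (hgen : IsGeneric π.contragredientRep ψ⁻¹) :
    Module.rank ℂ (whittakerFunctionals π ψ) ≤ 1 := by
  borelize (GL (Fin n) F)
  exact rank_whittakerFunctionals_le_one_of_gelfandKazhdan_pair π ψ hadm
    (biWhittaker_gkInvolution_stable ψ hψ) (biWhittaker_gkInvolution_stable ψ⁻¹ hψ.inv)
    ((isGeneric_iff _ _).1 hgen)

/-- The named fact `rank_whittakerFunctionals_le_one π ψ` for every `π` (irreducible smooth, any
universe) whose contragredient is `ψ⁻¹`-generic: admissibility from Jacquet's theorem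
(`jacquetAdmissibility_gl_holds` with `Representation.isAdmissible_of_jacquetAdmissibilityStatement_fin`).
[cite: GelfandKazhdan1975, §2] -/
theorem rank_whittakerFunctionals_le_one_of_isGeneric_contragredient'
    (hgen : IsGeneric π.contragredientRep ψ⁻¹) : rank_whittakerFunctionals_le_one π ψ := by
  intro _ hπ hψ
  have hadm : π.IsAdmissible :=
    Representation.isAdmissible_of_jacquetAdmissibilityStatement_fin (jacquetAdmissibility_gl_holds F n) π hπ
  exact rank_whittakerFunctionals_le_one_of_isGeneric_contragredient π ψ hadm hψ hgen

/-- **Multiplicity one for irreducible admissible `π` carrying a Gelfand–Kazhdan form**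
`B(π(g) ξ, π(ᵗg⁻¹) η) = B(ξ, η)` non-degenerate in the second variable (Gelfand–Kazhdan's
Theorem B = Bump 1997, Thm. 4.2.2 (i), here a hypothesis): Bump's deduction
`rank_whittakerFunctionals_le_one_of_gelfandKazhdan` with Theorem A discharged.
[cite: Bump1997, Theorem 4.4.1, pp. 457–459] -/
theorem rank_whittakerFunctionals_le_one_of_gelfandKazhdanForm [π.IsIrreducible]
    (hadm : π.IsAdmissible) (hψ : ψ.IsContinuousNontrivial)
    (hB : ∃ B : V →ₗ[ℂ] V →ₗ[ℂ] ℂ, (∀ η, (∀ ξ, B ξ η = 0) → η = 0) ∧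
      ∀ g ξ η, B (π g ξ) (π (glTransposeInv (Fin n) F g) η) = B ξ η) :
    Module.rank ℂ (whittakerFunctionals π ψ) ≤ 1 :=
  rank_whittakerFunctionals_le_one_of_gelfandKazhdan π ψ hadm (biWhittaker_gkInvolution_stable ψ hψ) hB

end LocalField

section TheoremB

open GaloisRepresentations (glTransposeInv)

variable {F : Type*} [Field F] [ValuativeRel F] [TopologicalSpace F] [IsNonarchimedeanLocalField F]
  {n : ℕ} {V : Type*} [AddCommGroup V] [Module ℂ V]
  (π : Representation ℂ (GL (Fin n) F) V) (ψ : AddChar F Circle)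

/-- **The named fact from Gelfand–Kazhdan's Theorem B alone**: with Theorem A
(`biWhittaker_gkInvolution_stable`) and Jacquet's admissibility theorem
(`jacquetAdmissibility_gl_holds`) in the tree, `rank_whittakerFunctionals_le_one π ψ` (any
universe of `V`) follows from Theorem B for the irreducible admissible `π` (`hB`: a bilinear form,
non-degenerate in the second variable, with `B(π(g) ξ, π(ᵗg⁻¹) η) = B(ξ, η)`; Gelfand–Kazhdan
1972, Thm. 1 = Bump 1997, Thm. 4.2.2 (i)). [cite: Bump1997, Theorem 4.4.1, p. 455] -/
theorem rank_whittakerFunctionals_le_one_of_theoremB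
    (hB : ∀ [π.IsIrreducible], π.IsAdmissible → ∃ B : V →ₗ[ℂ] V →ₗ[ℂ] ℂ,
      (∀ η, (∀ ξ, B ξ η = 0) → η = 0) ∧ ∀ g ξ η, B (π g ξ) (π (glTransposeInv (Fin n) F g) η) = B ξ η) :
    rank_whittakerFunctionals_le_one π ψ := by
  intro _ hπ hψ
  have hadm : π.IsAdmissible :=
    Representation.isAdmissible_of_jacquetAdmissibilityStatement_fin (jacquetAdmissibility_gl_holds F n) π hπ
  exact rank_whittakerFunctionals_le_one_of_gelfandKazhdanForm π ψ hadm hψ (hB hadm)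

end TheoremB

end Literature.NumberTheory.Automorphic
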